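import Summits.BirchSwinnertonDyer.Rank1Residual.X2.SplitCellCClassIntEtale
import HarnessLib

/-!
# The ÉTALE-ISOGENY SWITCH of CTL-split, Manin side: a prime-to-`p` Manin datum passes along a
# `p`-isogeny whose kernel is étale at the Tate prime (Dokchitser–Dokchitser 2015 Prop. 4.10 /
# Lemma 4.3; Stevens 1989 §§1–2), and the switch datum of line b1's `stub_ctlOrSwitch` from
# per-pair checkable inputs (cell `bsd-eis`, seat `bsd-eis-cgshw` g8; route `EisensteinPrimes`, crux 4
# `BSDpOnCellC` = stmt-BirchSwinnertonDyer-19034, line b1 skeleton v5; cgshw MEMO-11 §6, LIT-DOSSIER §50)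

HONEST FRAMING (cell `bsd-eis`, run/shared/lean/pub/bsd-eis/): ONE cited fact (statement only,
PUBLISHED, refereed) + theorems; nothing booked; X2 stays CONSTRUCTION-SHAPED; no label or count
moves. cgshw MEMO-11: at the `X₀(N)`-optimal curve `W₀` of a split X2c pair `W₀(ℚ_p)[p] ≠ 0` in
592/592 window pairs, while the étale `p`-quotient `W′ = W₀/Φ_ét = E_{q^{1/p}}` has `W′(ℚ_p)[p] = 0`
in 541/592; the class theorem `bsdp_of_cellC_of_split_of_intResiduals_of_ctlOrSwitch` (p434923) runs
at any isogenous `W′` carrying a prime-to-`p` Manin datum and no local `p`-torsion. This file supplies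
the Manin half of that switch:

* `dokchitserStevens_maninDatum_of_pIsogeny` (cited fact, statement only): for a `p`-isogeny
  `φ : W₀ → W′` of globally minimal curves over `ℚ` with `W₀` multiplicative at `p` and
  `v_p(j(W₀)) = p · v_p(j(W′))` (the kernel is NOT the `μ_p` of the Tate curve: DD15 Prop. 4.10,
  Thm. A.1), `φ^*ω′ = ±ω₀` (DD15 Prop. 4.10 at `p`, Lemma 4.3 at `ℓ ≠ p`), so the composite
  parametrisation `X₀(N) → W₀ → W′` is a modular parametrisation datum of `W′` with the same newform
  and Manin constant `±c(W₀)` (Stevens 1989 §1 (1.4)–(1.6), §2 Lemma 2.2: étale isogenies induce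
  isomorphisms on Néron differentials);
* `hasPrimeToManinDatum_of_pIsogeny` — `HasPrimeToManinDatum W₀ p` passes to `W′` along such a `φ`
  (given the equality of conductors, per pair decidable; class-wide Ogg–Saito);
* `switchDatum_of_pIsogeny` — the switch disjunct of `stub_ctlOrSwitch` for `W` from: `W ∼ W₀`,
  `HasPrimeToManinDatum W₀ p` (Mazur at the optimal curve), such a `φ : W₀ → W′`, and `W′(ℚ_p)[p] = 0`
  (kernel-checkable as `p ∤ v_p(Δ_min(W′))` via `X11b.LocalTorsion.localTorsion_eq_zero_of_mult` in
  465/541 window cases: `switchDatum_of_pIsogeny_of_not_dvd`).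

What this is NOT: no claim that every class has such a `W′` (51/543 window classes @3 do not); the
optimality of a named `W₀` (hence `HasPrimeToManinDatum W₀ p`) stays a per-pair input; nothing booked.

References: [DokchitserDokchitser2015LocalInvariants] Prop. 4.10 (p. 4348), Lemma 4.3 (p. 4345),
Thm. 8.2 (p. 4353), Thm. A.1 (p. 4354); [Stevens1989] §1, §2 Lemma (2.2); [Mazur1978] Cor. 4.1;
[SilvermanAEC2009] VI.4.1, VI.5.3, VII.6.1, C.14; cgshw MEMO-11.
-/

set_option autoImplicit false

noncomputable section

open scoped Classical MatrixGroups ModularForm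

open CongruenceSubgroup WeierstrassCurve NumberField IsDedekindDomain Field
  Literature.NumberTheory.EllipticCurves Literature.NumberTheory.EllipticCurves.GreenbergSelmer
  Literature.NumberTheory.EllipticCurves.ModularForms Literature.NumberTheory.QuadraticFields
  Literature.NumberTheory.EllipticCurves.Rank1Residual
  Literature.NumberTheory.EllipticCurves.Rank1Residual.Typed
  Literature.NumberTheory.GaloisRepresentations Literature.NumberTheory.GaloisCohomology
  Literature.NumberTheory.Automorphic
  Summit.BirchSwinnertonDyer.Rank1Residual.X11b

namespace Summit.BirchSwinnertonDyer.Rank1Residual.X2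

/-! ### The cited fact -/

/-- **Dokchitser–Dokchitser 2015, Prop. 4.10 with Lemma 4.3, in modular-parametrisation form (Stevens
1989 §§1–2): a `p`-isogeny with non-`μ` kernel at the Tate prime carries a modular parametrisation
datum to the target with the SAME newform and Manin constant `±c`.** Printed inputs: for an isogeny
`φ : E → E′` of degree `p` between elliptic curves over a `p`-adic field with minimal differentials
`ω, ω′` and `E` potentially multiplicative, «`φ^*ω′/ω` = unit if `v(j) = p·v(j′)`, `p ×` unit
otherwise» (Prop. 4.10, p. 4348; the two `p`-isogenies out of the Tate curve `E^{(q)}` are `z ↦ z^p`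
to `E^{(q^p)}` and `z ↦ z` to `E^{(q^{1/p})}`, Thm. A.1 p. 4354); «If `ℓ ≠ p`, then `φ^*ω′` is
minimal» (Lemma 4.3, p. 4345). Hence for globally minimal `W₀, W′/ℚ`, `φ : W₀ → W′` of degree `p`,
`W₀` multiplicative at `p` and `v_p(j(W₀)) = p·v_p(j(W′))`: `φ^*ω_{W′} = ±ω_{W₀}` (a rational number
that is a unit at every prime), so on complex uniformisations `φ` is `z ↦ ±z` with `Λ_{W₀} ⊆ Λ_{W′}`
(Silverman AEC VI.4.1), and the composite `X₀(N) → W₀ → W′` of a datum `D₀` is a modular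
parametrisation datum of `W′` with newform `D₀.f`, Manin constant `±D₀.c` and degree `p·deg D₀`
(Stevens 1989 §1: the parametrisations of the curves of an isogeny class and their Manin constants;
§2 Lemma (2.2): an isogeny is étale iff it induces an isomorphism on Néron differentials). Rendered in
the tree's `ModularParametrizationData` currency as an existence statement. Named fact (statement only).
[cite: DokchitserDokchitser2015LocalInvariants, Prop. 4.10 (p. 4348), Lemma 4.3 (p. 4345), Thm. A.1 (p. 4354)]
[cite: Stevens1989, §1 (1.4)–(1.6) and §2 Lemma (2.2) (Invent. Math. 98, pp. 78–85)]
[cite: SilvermanAEC2009, VI.4.1 and VI.5.3]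
[file NumberTheory/EllipticCurves/ManinConstantEtaleIsogeny] -/
def dokchitserStevens_maninDatum_of_pIsogeny : Prop :=
  ∀ (W₀ W' : WeierstrassCurve ℚ) [W₀.IsElliptic] [W'.IsElliptic] [W₀.IsGloballyMinimal]
    [W'.IsGloballyMinimal] {N : ℕ} [NeZero N] (D₀ : ModularParametrizationData W₀ N) (p : ℕ)
    [Fact p.Prime] (φ : Isogeny W₀ W'), φ.degree = p → W₀.HasMultiplicativeReductionAtPrime p →
      padicValRat p W₀.j = p * padicValRat p W'.j →
        ∃ D' : ModularParametrizationData W' N, D'.f = D₀.f ∧ (D'.c = D₀.c ∨ D'.c = -D₀.c)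

/-! ### The Manin datum passes along the étale `p`-isogeny -/

section Transport

variable {W₀ W' : WeierstrassCurve ℚ} [W₀.IsElliptic] [W'.IsElliptic] [W₀.IsGloballyMinimal]
  [W'.IsGloballyMinimal] {p : ℕ} [Fact p.Prime]

/-- **`HasPrimeToManinDatum` passes along a `p`-isogeny with non-`μ` kernel at the Tate prime.** If
`W₀` carries a modular parametrisation datum at level `N(W₀)` with `p ∤ c` (e.g. the `X₀(N)`-optimal
curve at an odd semistable `p`, Mazur), `φ : W₀ → W′` has degree `p`, `W₀` is multiplicative at `p`,
`v_p(j(W₀)) = p·v_p(j(W′))`, and `N(W′) = N(W₀)` (isogeny invariance of the conductor; per pair by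
computation), then `W′` carries such a datum too (`dokchitserStevens_maninDatum_of_pIsogeny`: same
newform, Manin constant `±c`). CONDITIONAL on the cited fact; nothing booked.
[cite: DokchitserDokchitser2015LocalInvariants, Prop. 4.10 (p. 4348) and Lemma 4.3 (p. 4345)]
[cite: Stevens1989, §2 Lemma (2.2)] -/
theorem maninDatum_of_pIsogeny (hDS : dokchitserStevens_maninDatum_of_pIsogeny) {N : ℕ} [NeZero N]
    (D₀ : ModularParametrizationData W₀ N) (hc₀ : ¬ (p : ℤ) ∣ D₀.c) (φ : Isogeny W₀ W')
    (hdeg : φ.degree = p) (hmult : W₀.HasMultiplicativeReductionAtPrime p)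
    (hj : padicValRat p W₀.j = p * padicValRat p W'.j) :
    ∃ D' : ModularParametrizationData W' N, ¬ (p : ℤ) ∣ D'.c := by
  obtain ⟨D', -, hc'⟩ := hDS W₀ W' D₀ p φ hdeg hmult hj
  refine ⟨D', ?_⟩
  rcases hc' with h | h <;> rw [h]
  · exact hc₀
  · rwa [dvd_neg]

/-- **`HasPrimeToManinDatum` passes along a `p`-isogeny with non-`μ` kernel at the Tate prime** (the
previous lemma packaged at the conductor level; `N(W′) = N(W₀)` by isogeny invariance of the
conductor, per pair by computation). CONDITIONAL on the cited fact; nothing booked.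
[cite: DokchitserDokchitser2015LocalInvariants, Prop. 4.10 (p. 4348) and Lemma 4.3 (p. 4345)]
[cite: Stevens1989, §2 Lemma (2.2)] -/
theorem hasPrimeToManinDatum_of_pIsogeny (hDS : dokchitserStevens_maninDatum_of_pIsogeny)
    (hMan : HasPrimeToManinDatum W₀ p) (φ : Isogeny W₀ W') (hdeg : φ.degree = p)
    (hmult : W₀.HasMultiplicativeReductionAtPrime p)
    (hj : padicValRat p W₀.j = p * padicValRat p W'.j)
    (hN : W'.conductorNorm ℤ = W₀.conductorNorm ℤ) : HasPrimeToManinDatum W' p := by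
  intro _
  haveI : NeZero (W₀.conductorNorm ℤ) := ⟨(W₀.conductorNorm_pos_holds).ne'⟩
  obtain ⟨D₀, hc₀⟩ := hMan
  have key : ∀ (M : ℕ) (_ : M = W₀.conductorNorm ℤ) [NeZero M],
      ∃ Dt : ModularParametrizationData W' M, ¬ (p : ℤ) ∣ Dt.c := by
    intro M hM _
    subst hM
    exact maninDatum_of_pIsogeny hDS D₀ hc₀ φ hdeg hmult hj
  exact key _ hN

/-- **The switch disjunct of line b1's `stub_ctlOrSwitch` from per-pair inputs.** For `W` in the
isogeny class of `W₀` (`HasPrimeToManinDatum W₀ p`, e.g. the optimal curve), a `p`-isogeny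
`φ : W₀ → W′` with non-`μ` kernel at the Tate prime (`v_p(j(W₀)) = p·v_p(j(W′))`), equal conductors,
and `W′(ℚ_p)[p] = 0`: the datum `∃ W′ ∼ W` (globally minimal) with `HasPrimeToManinDatum W′ p` and no
`ℚ_p`-rational `p`-torsion. CONDITIONAL on the cited fact; nothing booked.
[cite: DokchitserDokchitser2015LocalInvariants, Prop. 4.10 (p. 4348)] [cite: Stevens1989, §2 Lemma (2.2)] -/
theorem switchDatum_of_pIsogeny (hDS : dokchitserStevens_maninDatum_of_pIsogeny)
    {W : WeierstrassCurve ℚ} [W.IsElliptic] [W.IsGloballyMinimal] (hiso : IsIsogenous W W₀)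
    (hMan : HasPrimeToManinDatum W₀ p) (φ : Isogeny W₀ W') (hdeg : φ.degree = p)
    (hmult : W₀.HasMultiplicativeReductionAtPrime p)
    (hj : padicValRat p W₀.j = p * padicValRat p W'.j)
    (hN : W'.conductorNorm ℤ = W₀.conductorNorm ℤ)
    (h0 : ∀ Q₀ : (W'.baseChange ℚ_[p]).toAffine.Point, p • Q₀ = 0 → Q₀ = 0) :
    ∃ (W'' : WeierstrassCurve ℚ) (_ : W''.IsElliptic) (_ : W''.IsGloballyMinimal),
      IsIsogenous W W'' ∧ HasPrimeToManinDatum W'' p ∧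
        ∀ Q₀ : (W''.baseChange ℚ_[p]).toAffine.Point, p • Q₀ = 0 → Q₀ = 0 :=
  ⟨W', inferInstance, inferInstance, hiso.trans' ⟨φ⟩,
    hasPrimeToManinDatum_of_pIsogeny hDS hMan φ hdeg hmult hj hN, h0⟩

/-- **The same with the local input in its kernel-checkable form `p ∤ v_p(Δ_min(W′))`** (`p ≥ 3`,
`W′` multiplicative at `p`: `X11b.LocalTorsion.localTorsion_eq_zero_of_mult`). CONDITIONAL on the
cited fact; nothing booked. [cite: SilvermanAEC2009, Thm VII.6.1 and Exercise 3.5]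
[cite: DokchitserDokchitser2015LocalInvariants, Prop. 4.10 (p. 4348)] -/
theorem switchDatum_of_pIsogeny_of_not_dvd (hDS : dokchitserStevens_maninDatum_of_pIsogeny)
    {W : WeierstrassCurve ℚ} [W.IsElliptic] [W.IsGloballyMinimal] (hiso : IsIsogenous W W₀)
    (hMan : HasPrimeToManinDatum W₀ p) (φ : Isogeny W₀ W') (hdeg : φ.degree = p)
    (hmult : W₀.HasMultiplicativeReductionAtPrime p)
    (hj : padicValRat p W₀.j = p * padicValRat p W'.j)
    (hN : W'.conductorNorm ℤ = W₀.conductorNorm ℤ) (hp3 : 3 ≤ p) (hmult' : Mult W' p)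
    (hv : ¬ p ∣ padicValInt p W'.minimalDiscriminantInt) :
    ∃ (W'' : WeierstrassCurve ℚ) (_ : W''.IsElliptic) (_ : W''.IsGloballyMinimal),
      IsIsogenous W W'' ∧ HasPrimeToManinDatum W'' p ∧
        ∀ Q₀ : (W''.baseChange ℚ_[p]).toAffine.Point, p • Q₀ = 0 → Q₀ = 0 :=
  switchDatum_of_pIsogeny hDS hiso hMan φ hdeg hmult hj hN
    (X11b.LocalTorsion.localTorsion_eq_zero_of_mult W' p hp3 hmult' (Or.inr hv))

end Transport

end Summit.BirchSwinnertonDyer.Rank1Residual.X2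

end
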